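import Literature.Barriers.RiemannHypothesis.MollifierLimitationsPropAInputs
import Literature.Barriers.RiemannHypothesis.MollifierLimitationsPropABump
import Mathlib.Analysis.SpecialFunctions.ImproperIntegrals
import Mathlib.NumberTheory.LSeries.RiemannZeta
import HarnessLib

/-!
# Radziwiłł 2012, Proposition A: the deduction of §3

Sibling of `MollifierLimitationsProofs.lean` (which vendors Proposition A of M. Radziwiłł,
*Limitations to mollifying `ζ(s)`*, arXiv:1207.6583, as the named fact `Radziwill2012_propA` and
proves Theorem 1 from it), of `MollifierLimitationsPropAInputs.lean` (Lemmas 1, 3–4 proved;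
Lemma 2 a named fact) and of `MollifierLimitationsPropABump.lean` (the test function `f` of §3). Here the printed proof of Proposition A (§3, p. 7) is carried out:

`Radziwill2012_propA_of_lemma2 : Radziwill2012_lemma2 → Radziwill2012_propA`.

So after this file the trust base of Proposition A (and, through `Radziwill2012_thm1_of_inputs`,
of the `θ ≥ ½` half of Theorem 1 together with Selberg's lemma) is exactly Bombieri–Friedlander's
smoothed approximation of `ζ` by a Dirichlet polynomial of length `T^{1+η}` (Lemma 2); Lemma 1,
Lemmas 3–4 (via the tree's continuous large sieve inequality
`Literature.NumberTheory.Sieve.largeSieve_integral`) and the whole of §3 are theorems.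

## The argument (§3), as formalised

Fix `ε, θ, A, C`; put `η = ε/4`, margins `ε'T` with `ε' = min(εA/4, 1/4)` (the paper uses
margins `T^η`; any `o(T)` margin works, and a margin `ε'T` costs `≤ 2ε'/A ≤ ε/2` in the final
bound, which the vendored statement's `−ε` absorbs), `v = 2θ + 3`, `k = ⌈2θ⌉ + 4` derivatives.
For `T` large, `N = ⌊T^θ⌋`, `X = T^{1+η}`, an admissible `a` and a `δ = 2πA/log T`-spaced set `S`
of critical ordinates in `[T, 2T]`:

1. (Lemma 2) `Z(t) = Σ_{m ≤ X} w(m/X) m^{-½-it}` has `|ζ(½+it) − Z(t)| ≤ C_w T^{-v}` on `[T, 2T]`;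
   `M(t) = Σ_{n ≤ N} a(n) n^{-½-it}`, `|M| ≤ Σ|a(n)| ≤ C₁T^{2θ}`; `P = 1 − ZM` is a trigonometric
   sum with frequencies `log(mn) ∈ [0, (1+η+θ) log T]`, `|P| ≤ 1 + X C₁ T^{2θ}`; `F = 1 − ζM`.
2. (Lemma 1) with `f = f_L`, `L = (1+η+θ) log T/2π` (`f(0) = 1`, `f(log(mn)/2π) = 1`):
   `P(u) = ∫_ℝ P(t) f̂(t − u) dt` for all `u` (`f̂ = 𝓕⁻ f`).
3. For `γ ∈ S_in = S ∩ [T + ε'T, 2T − ε'T]`: `|P(γ) − 1| = |Z(γ) − ζ(½+iγ)| |M(γ)|`, the tail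
   `∫_{t ∉ [T,2T]}` costs `sup|P| · ∫_{|x| ≥ ε'T} |f̂|`, and replacing `P` by `F` on `[T, 2T]` costs
   `sup_{[T,2T]}|P − F| · ‖f̂‖₁`; all three are `≪ 1/T`, so `|1 − ∫_T^{2T} F(t) f̂(t−γ) dt| ≤ e ≤ ε/4`
   (`norm_one_sub_setIntegral_le`).
4. Summing over `S_in` (`n₀` elements), Cauchy–Schwarz, and Lemmas 3–4 in the form
   `∫_ℝ |Σ_γ f̂(t−γ)|² ≤ K₀ n₀`, `K₀ = |supp f| + 1/δ = (log T/2π)(1 + θ + 1/A + η + 2/log T)`: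
   `n₀ (1 − e)² ≤ K₀ ∫_T^{2T} |F|² = K₀ T 𝓘` (`card_mul_sq_le_of_forall_norm_one_sub_le`).
5. `n₀ ≥ Card S − 2(ε'T/δ + 1)` (well-spacing), and the algebra of §4's first display gives
   `𝓘 ≥ (1−ε)/(1+θ+1/A) · Card S/((T/2π) log T) − ε`.

## References

* [Radziwill2012] M. Radziwiłł, *Limitations to mollifying ζ(s)*, arXiv:1207.6583, §3 (p. 7).
-/

noncomputable section

open Complex MeasureTheory Real Set SchwartzMap Filter Topology
open scoped FourierTransform ContDiff

namespace Literature.Barriers.RiemannHypothesis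

/-! ## Tail and `L¹` bounds from pointwise decay -/

/-- If `‖φ x‖ ≤ D/|x|^k` for `x ≠ 0` (`k ≥ 2`) then `∫_{x > R} ‖φ‖ ≤ D R^{1-k}/(k−1)` for
`R > 0`. [folklore] -/
theorem setIntegral_Ioi_norm_le_of_decay {φ : ℝ → ℂ} (hφ : Integrable φ) {D : ℝ} {k : ℕ}
    (hk : 2 ≤ k) (hdec : ∀ x : ℝ, x ≠ 0 → ‖φ x‖ ≤ D / |x| ^ k) {R : ℝ} (hR : 0 < R) :
    ∫ x in Ioi R, ‖φ x‖ ≤ D * R ^ (1 - (k : ℝ)) / (k - 1) := by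
  have hk1 : (-(k : ℝ)) < -1 := by
    have : (2 : ℝ) ≤ k := by exact_mod_cast hk
    linarith
  have hint : IntegrableOn (fun x : ℝ ↦ D * x ^ (-(k : ℝ))) (Ioi R) :=
    ((integrableOn_Ioi_rpow_of_lt hk1 hR).const_mul D)
  calc ∫ x in Ioi R, ‖φ x‖ ≤ ∫ x in Ioi R, D * x ^ (-(k : ℝ)) := by
        apply setIntegral_mono_on hφ.norm.integrableOn hint measurableSet_Ioi
        intro x hx
        have hx0 : 0 < x := hR.trans hx
        have := hdec x hx0.ne'
        rw [abs_of_pos hx0] at this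
        rw [Real.rpow_neg hx0.le, Real.rpow_natCast, ← div_eq_mul_inv]
        exact this
    _ = D * R ^ (1 - (k : ℝ)) / (k - 1) := by
        rw [integral_const_mul, integral_Ioi_rpow_of_lt hk1 hR]
        have : (-(k : ℝ) + 1) = 1 - k := by ring
        rw [this]
        have hk0 : (1 - (k : ℝ)) ≠ 0 := by linarith
        have hk0' : ((k : ℝ) - 1) ≠ 0 := by linarith
        field_simp
        ring

/-- Two-sided tail: if `‖φ x‖ ≤ D/|x|^k` for `x ≠ 0` (`k ≥ 2`) then
`∫_{|x| ≥ R} ‖φ‖ ≤ 2 D R^{1-k}/(k−1)` for `R > 0`. [folklore] -/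
theorem setIntegral_norm_le_of_decay {φ : ℝ → ℂ} (hφ : Integrable φ) {D : ℝ} {k : ℕ}
    (hk : 2 ≤ k) (hdec : ∀ x : ℝ, x ≠ 0 → ‖φ x‖ ≤ D / |x| ^ k) {R : ℝ} (hR : 0 < R) :
    ∫ x in {x : ℝ | R ≤ |x|}, ‖φ x‖ ≤ 2 * (D * R ^ (1 - (k : ℝ)) / (k - 1)) := by
  -- `{R ≤ |x|} ⊆ Iic (-R) ∪ Ici R`
  have hsub : {x : ℝ | R ≤ |x|} ⊆ Iic (-R) ∪ Ici R := by
    intro x hx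
    simp only [mem_setOf_eq] at hx
    rcases le_or_gt 0 x with h | h
    · rw [abs_of_nonneg h] at hx; exact Or.inr hx
    · rw [abs_of_neg h] at hx; exact Or.inl (by simp only [mem_Iic]; linarith)
  -- the right tail
  have h1 : ∫ x in Ici R, ‖φ x‖ ≤ D * R ^ (1 - (k : ℝ)) / (k - 1) := by
    rw [setIntegral_congr_set (Ioi_ae_eq_Ici (a := R) (μ := volume)).symm]
    exact setIntegral_Ioi_norm_le_of_decay hφ hk hdec hR
  -- the left tail, by the symmetry `x ↦ -x`
  have h2 : ∫ x in Iic (-R), ‖φ x‖ ≤ D * R ^ (1 - (k : ℝ)) / (k - 1) := by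
    have hφ' : Integrable (fun x : ℝ ↦ φ (-x)) := hφ.comp_neg
    have hdec' : ∀ x : ℝ, x ≠ 0 → ‖φ (-x)‖ ≤ D / |x| ^ k := by
      intro x hx
      have := hdec (-x) (neg_ne_zero.2 hx)
      rwa [abs_neg] at this
    have key := setIntegral_Ioi_norm_le_of_decay hφ' hk hdec' hR
    calc ∫ x in Iic (-R), ‖φ x‖ = ∫ x in Ioi R, ‖φ (-x)‖ :=
          (integral_comp_neg_Ioi R (fun x ↦ ‖φ x‖)).symm
      _ ≤ _ := key
  have hdisj : Disjoint (Iic (-R)) (Ici R) := Set.Iic_disjoint_Ici.2 (by linarith)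
  calc ∫ x in {x : ℝ | R ≤ |x|}, ‖φ x‖ ≤ ∫ x in Iic (-R) ∪ Ici R, ‖φ x‖ :=
        setIntegral_mono_set hφ.norm.integrableOn (ae_of_all _ fun _ ↦ norm_nonneg _)
          (Eventually.of_forall hsub)
    _ = (∫ x in Iic (-R), ‖φ x‖) + ∫ x in Ici R, ‖φ x‖ :=
        setIntegral_union hdisj measurableSet_Ici hφ.norm.integrableOn hφ.norm.integrableOn
    _ ≤ _ := by linarith

/-- `L¹` bound: if `‖φ‖ ≤ B` everywhere and `‖φ x‖ ≤ D/|x|^k` for `x ≠ 0` (`k ≥ 2`) then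
`∫ ‖φ‖ ≤ 2B + 2D/(k−1)`. [folklore] -/
theorem integral_norm_le_of_decay {φ : ℝ → ℂ} (hφ : Integrable φ) {B D : ℝ} {k : ℕ}
    (hk : 2 ≤ k) (hB : ∀ x, ‖φ x‖ ≤ B) (hdec : ∀ x : ℝ, x ≠ 0 → ‖φ x‖ ≤ D / |x| ^ k) :
    ∫ x, ‖φ x‖ ≤ 2 * B + 2 * (D / (k - 1)) := by
  have htail := setIntegral_norm_le_of_decay hφ hk hdec zero_lt_one
  simp only [Real.one_rpow, mul_one] at htail
  have hmeas : MeasurableSet {x : ℝ | 1 ≤ |x|} :=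
    measurableSet_le measurable_const continuous_abs.measurable
  rw [← integral_add_compl hmeas hφ.norm]
  have hB0 : 0 ≤ B := (norm_nonneg _).trans (hB 0)
  have hcompl : {x : ℝ | 1 ≤ |x|}ᶜ ⊆ Ioo (-1) 1 := by
    intro x hx
    simp only [mem_compl_iff, mem_setOf_eq, not_le] at hx
    exact ⟨by linarith [neg_abs_le x], by linarith [le_abs_self x]⟩
  have hin : ∫ x in {x : ℝ | 1 ≤ |x|}ᶜ, ‖φ x‖ ≤ 2 * B := by
    calc ∫ x in {x : ℝ | 1 ≤ |x|}ᶜ, ‖φ x‖ ≤ ∫ x in Ioo (-1 : ℝ) 1, ‖φ x‖ :=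
          setIntegral_mono_set hφ.norm.integrableOn (Eventually.of_forall fun _ ↦ norm_nonneg _)
            (Eventually.of_forall hcompl)
      _ ≤ ∫ x in Ioo (-1 : ℝ) 1, B := by
          apply setIntegral_mono_on hφ.norm.integrableOn (by simp) measurableSet_Ioo
          intro x _; exact hB x
      _ = 2 * B := by
          rw [setIntegral_const, smul_eq_mul, Real.volume_real_Ioo_of_le (by norm_num)]
          ring
  linarith

/-! ## §3 at one well-placed zero -/

/-- Change of variables for the tail: if `γ ∈ [T + R, 2T − R]` (`R ≥ 0`) then
`∫_{t ∉ [T,2T]} ‖φ(t − γ)‖ dt ≤ ∫_{|x| ≥ R} ‖φ(x)‖ dx`. [folklore] -/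
theorem setIntegral_compl_Icc_norm_comp_sub_le {φ : ℝ → ℂ} (hφ : Integrable φ) {T R γ : ℝ}
    (hR : 0 ≤ R) (hγ : γ ∈ Icc (T + R) (2 * T - R)) :
    ∫ t in (Icc T (2 * T))ᶜ, ‖φ (t - γ)‖ ≤ ∫ x in {x : ℝ | R ≤ |x|}, ‖φ x‖ := by
  have hmeasA : MeasurableSet {x : ℝ | R ≤ |x|} :=
    measurableSet_le measurable_const continuous_abs.measurable
  have hI : Integrable (fun x ↦ {x : ℝ | R ≤ |x|}.indicator (fun x ↦ ‖φ x‖) x) :=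
    hφ.norm.indicator hmeasA
  calc ∫ t in (Icc T (2 * T))ᶜ, ‖φ (t - γ)‖
      = ∫ t, (Icc T (2 * T))ᶜ.indicator (fun t ↦ ‖φ (t - γ)‖) t :=
        (integral_indicator measurableSet_Icc.compl).symm
    _ ≤ ∫ t, {x : ℝ | R ≤ |x|}.indicator (fun x ↦ ‖φ x‖) (t - γ) := by
        apply integral_mono ((hφ.comp_sub_right γ).norm.indicator measurableSet_Icc.compl)
          (hI.comp_sub_right γ)
        intro t
        by_cases ht : t ∈ (Icc T (2 * T))ᶜ
        · rw [indicator_of_mem ht]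
          have hA : t - γ ∈ {x : ℝ | R ≤ |x|} := by
            simp only [mem_setOf_eq]
            simp only [mem_compl_iff, mem_Icc, not_and_or, not_le] at ht
            rcases ht with ht | ht
            · rw [abs_of_nonpos (by linarith [hγ.1])]
              linarith [hγ.1]
            · rw [abs_of_nonneg (by linarith [hγ.2])]
              linarith [hγ.2]
          simp only [indicator_of_mem hA, le_refl]
        · rw [indicator_of_notMem ht]
          exact indicator_nonneg (fun _ _ ↦ norm_nonneg _) _
    _ = ∫ x, {x : ℝ | R ≤ |x|}.indicator (fun x ↦ ‖φ x‖) x :=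
        integral_sub_right_eq_self (fun x ↦ {x : ℝ | R ≤ |x|}.indicator (fun x ↦ ‖φ x‖) x) γ
    _ = ∫ x in {x : ℝ | R ≤ |x|}, ‖φ x‖ := integral_indicator hmeasA

/-- **§3, at one zero.** Let `F` be continuous on `[T, 2T]`, `P` continuous and bounded by `Pmax`
with `|P − F| ≤ e₁` on `[T, 2T]`, `φ` continuous and integrable with `‖φ‖₁ ≤ Φ₁` and tail
`∫_{|x| ≥ R} |φ| ≤ Φt`, and suppose the reproducing identity `P(u) = ∫ P(t) φ(t − u) dt`. If
`γ ∈ [T + R, 2T − R]` has `|P(γ) − 1| ≤ e₂`, then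
`|1 − ∫_{[T,2T]} F(t) φ(t − γ) dt| ≤ e₂ + Pmax · Φt + e₁ · Φ₁` (the three displays of §3 leading
to "`1 − ζ(½+iu)M(½+iu) = ∫_T^{2T} (1 − ζM)(½+it) f̂(t − u) dt + O(T^{-v})`" at `u = γ`).
[cite: Radziwill2012, §3] -/
theorem norm_one_sub_setIntegral_le {T R : ℝ} (hT : 0 < T) (hR : 0 ≤ R) {F P φ : ℝ → ℂ}
    (hF : ContinuousOn F (Icc T (2 * T))) (hP : Continuous P) (hφc : Continuous φ)
    (hφ : Integrable φ) {Pmax e₁ e₂ Φ₁ Φt : ℝ} (hPmax : ∀ t, ‖P t‖ ≤ Pmax)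
    (hPF : ∀ t ∈ Icc T (2 * T), ‖P t - F t‖ ≤ e₁) (hΦ₁ : ∫ x, ‖φ x‖ ≤ Φ₁)
    (hΦt : ∫ x in {x : ℝ | R ≤ |x|}, ‖φ x‖ ≤ Φt) (hrep : ∀ u : ℝ, ∫ t, P t * φ (t - u) = P u)
    {γ : ℝ} (hγ : γ ∈ Icc (T + R) (2 * T - R)) (hPγ : ‖P γ - 1‖ ≤ e₂) :
    ‖1 - ∫ t in Icc T (2 * T), F t * φ (t - γ)‖ ≤ e₂ + Pmax * Φt + e₁ * Φ₁ := by
  set ψ : ℝ → ℂ := fun t ↦ φ (t - γ) with hψ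
  have hψi : Integrable ψ := hφ.comp_sub_right γ
  have hψc : Continuous ψ := hφc.comp (continuous_id.sub continuous_const)
  have hPmax0 : 0 ≤ Pmax := (norm_nonneg _).trans (hPmax 0)
  have hTI : T ∈ Icc T (2 * T) := ⟨le_rfl, by linarith⟩
  have he₁ : 0 ≤ e₁ := (norm_nonneg _).trans (hPF T hTI)
  have hPψ : Integrable (fun t ↦ P t * ψ t) :=
    hψi.bdd_mul hP.aestronglyMeasurable (Eventually.of_forall hPmax)
  have hFψ : IntegrableOn (fun t ↦ F t * ψ t) (Icc T (2 * T)) :=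
    (hF.mul hψc.continuousOn).integrableOn_Icc
  have hPψ' : IntegrableOn (fun t ↦ P t * ψ t) (Icc T (2 * T)) := hPψ.integrableOn
  -- split `∫ Pψ = ∫_{Icc} Pψ + ∫_{Iccᶜ} Pψ`
  have hsplit := integral_add_compl (μ := volume) (s := Icc T (2 * T)) measurableSet_Icc hPψ
  have hrepγ : ∫ t, P t * ψ t = P γ := hrep γ
  -- the three error terms
  have hE1 : ‖(∫ t in Icc T (2 * T), P t * ψ t) - ∫ t in Icc T (2 * T), F t * ψ t‖ ≤
      e₁ * Φ₁ := by
    rw [← integral_sub hPψ' hFψ]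
    calc ‖∫ t in Icc T (2 * T), (P t * ψ t - F t * ψ t)‖
        ≤ ∫ t in Icc T (2 * T), e₁ * ‖ψ t‖ := by
          apply norm_integral_le_of_norm_le (hψi.norm.const_mul e₁).integrableOn
          rw [ae_restrict_iff' measurableSet_Icc]
          filter_upwards with t ht
          rw [← sub_mul, norm_mul]
          exact mul_le_mul_of_nonneg_right (hPF t ht) (norm_nonneg _)
      _ ≤ ∫ t, e₁ * ‖ψ t‖ := setIntegral_le_integral (hψi.norm.const_mul e₁)
            (Eventually.of_forall fun t ↦ by positivity)
      _ = e₁ * ∫ t, ‖φ t‖ := by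
          rw [integral_const_mul]
          congr 1
          exact integral_sub_right_eq_self (fun t ↦ ‖φ t‖) γ
      _ ≤ e₁ * Φ₁ := mul_le_mul_of_nonneg_left hΦ₁ he₁
  have hE2 : ‖∫ t in (Icc T (2 * T))ᶜ, P t * ψ t‖ ≤ Pmax * Φt := by
    calc ‖∫ t in (Icc T (2 * T))ᶜ, P t * ψ t‖ ≤ ∫ t in (Icc T (2 * T))ᶜ, Pmax * ‖ψ t‖ := by
          apply norm_integral_le_of_norm_le (hψi.norm.const_mul Pmax).integrableOn
          filter_upwards with t
          rw [norm_mul]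
          exact mul_le_mul_of_nonneg_right (hPmax t) (norm_nonneg _)
      _ = Pmax * ∫ t in (Icc T (2 * T))ᶜ, ‖ψ t‖ := integral_const_mul _ _
      _ ≤ Pmax * Φt := by
          apply mul_le_mul_of_nonneg_left _ hPmax0
          exact (setIntegral_compl_Icc_norm_comp_sub_le hφ hR hγ).trans hΦt
  -- assemble
  have hid : (1 : ℂ) - ∫ t in Icc T (2 * T), F t * ψ t =
      (1 - P γ) + (((∫ t in Icc T (2 * T), P t * ψ t) - ∫ t in Icc T (2 * T), F t * ψ t) +
        ∫ t in (Icc T (2 * T))ᶜ, P t * ψ t) := by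
    rw [← hrepγ, ← hsplit]; ring
  rw [hid]
  calc ‖(1 - P γ) + (((∫ t in Icc T (2 * T), P t * ψ t) - ∫ t in Icc T (2 * T), F t * ψ t) +
        ∫ t in (Icc T (2 * T))ᶜ, P t * ψ t)‖
      ≤ ‖1 - P γ‖ + (‖(∫ t in Icc T (2 * T), P t * ψ t) - ∫ t in Icc T (2 * T), F t * ψ t‖ +
        ‖∫ t in (Icc T (2 * T))ᶜ, P t * ψ t‖) :=
        (norm_add_le _ _).trans (by gcongr; exact norm_add_le _ _)
    _ ≤ e₂ + (e₁ * Φ₁ + Pmax * Φt) := by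
        gcongr
        rwa [norm_sub_rev]
    _ = e₂ + Pmax * Φt + e₁ * Φ₁ := by ring

/-! ## §3: summing over the zeros and Cauchy–Schwarz -/

/-- Cauchy–Schwarz for set integrals of real functions:
`∫_s u v ≤ (∫_s u²)^{1/2} (∫_s v²)^{1/2}`, by the discriminant of `λ ↦ ∫_s (λu − v)² ≥ 0`.
[folklore] -/
theorem setIntegral_mul_le_sqrt_mul_sqrt {u v : ℝ → ℝ} {s : Set ℝ}
    (hu2 : IntegrableOn (fun x ↦ u x ^ 2) s) (hv2 : IntegrableOn (fun x ↦ v x ^ 2) s)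
    (huv : IntegrableOn (fun x ↦ u x * v x) s) :
    ∫ x in s, u x * v x ≤ Real.sqrt (∫ x in s, u x ^ 2) * Real.sqrt (∫ x in s, v x ^ 2) := by
  set A : ℝ := ∫ x in s, u x ^ 2 with hA
  set B : ℝ := ∫ x in s, u x * v x with hB
  set C : ℝ := ∫ x in s, v x ^ 2 with hC
  have hA0 : 0 ≤ A := integral_nonneg fun x ↦ sq_nonneg _
  have hC0 : 0 ≤ C := integral_nonneg fun x ↦ sq_nonneg _
  have key : ∀ l : ℝ, 0 ≤ A * l ^ 2 - 2 * B * l + C := by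
    intro l
    have h0 : 0 ≤ ∫ x in s, (l * u x - v x) ^ 2 := integral_nonneg fun x ↦ sq_nonneg _
    have e : ∫ x in s, (l * u x - v x) ^ 2 = A * l ^ 2 - 2 * B * l + C := by
      have : (fun x ↦ (l * u x - v x) ^ 2) =
          fun x ↦ (l ^ 2 * u x ^ 2 - 2 * l * (u x * v x)) + v x ^ 2 := by
        funext x; ring
      have hi1 : IntegrableOn (fun x ↦ l ^ 2 * u x ^ 2 - 2 * l * (u x * v x)) s :=
        (hu2.const_mul _).sub (huv.const_mul _)
      rw [this, integral_add hi1 hv2, integral_sub (hu2.const_mul _) (huv.const_mul _),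
        integral_const_mul, integral_const_mul]
      ring
    linarith
  rcases le_or_gt B 0 with hB0 | hB0
  · exact hB0.trans (by positivity)
  have hB2 : B ^ 2 ≤ A * C := by
    rcases hA0.eq_or_lt with hA00 | hApos
    · have h := key ((C + 1) / (2 * B))
      rw [← hA00] at h
      have : 2 * B * ((C + 1) / (2 * B)) = C + 1 := by field_simp
      nlinarith
    · have h := key (B / A)
      have e : A * (B / A) ^ 2 - 2 * B * (B / A) + C = C - B ^ 2 / A := by
        field_simp; ring
      rw [e, sub_nonneg, div_le_iff₀ hApos] at h
      linarith
  calc B = Real.sqrt (B ^ 2) := (Real.sqrt_sq hB0.le).symm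
    _ ≤ Real.sqrt (A * C) := Real.sqrt_le_sqrt hB2
    _ = Real.sqrt A * Real.sqrt C := Real.sqrt_mul hA0 C

/-- **§3, summed over the zeros.** If `|1 − ∫_{[T,2T]} F(t) φ(t − γ) dt| ≤ e ≤ 1` for every
`γ` in a finite set `S₀`, and `∫_ℝ |Σ_{γ∈S₀} φ(t − γ)|² ≤ K · Card S₀`, then
`Card S₀ · (1 − e)² ≤ K · ∫_{[T,2T]} |F|²` ("By Cauchy–Schwarz `Card(S) ≤ (∫|1 − ζM|²)^{1/2}`
`(∫|Σ_γ f̂(t − γ)|²)^{1/2} + O(T^{-v})`", §3). [cite: Radziwill2012, §3] -/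
theorem card_mul_sq_le_of_forall_norm_one_sub_le {T : ℝ} {F φ : ℝ → ℂ}
    (hF : ContinuousOn F (Icc T (2 * T))) (hφc : Continuous φ) (S₀ : Finset ℝ) {e K : ℝ}
    (he1 : e ≤ 1) (hK : 0 ≤ K)
    (hper : ∀ γ ∈ S₀, ‖1 - ∫ t in Icc T (2 * T), F t * φ (t - γ)‖ ≤ e)
    (hGint : Integrable fun t ↦ ‖∑ γ ∈ S₀, φ (t - γ)‖ ^ 2)
    (hLS : ∫ t, ‖∑ γ ∈ S₀, φ (t - γ)‖ ^ 2 ≤ K * S₀.card) :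
    (S₀.card : ℝ) * (1 - e) ^ 2 ≤ K * ∫ t in Icc T (2 * T), ‖F t‖ ^ 2 := by
  set G : ℝ → ℂ := fun t ↦ ∑ γ ∈ S₀, φ (t - γ) with hG
  have hGc : Continuous G := by
    simp only [hG]
    exact continuous_finsetSum _ fun γ _ ↦ hφc.comp (continuous_id.sub continuous_const)
  set n : ℝ := (S₀.card : ℝ) with hn
  set IF : ℝ := ∫ t in Icc T (2 * T), ‖F t‖ ^ 2 with hIF
  have hIF0 : 0 ≤ IF := integral_nonneg fun t ↦ sq_nonneg _
  rcases S₀.eq_empty_or_nonempty with h0 | hne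
  · simp only [hn, h0, Finset.card_empty, CharP.cast_eq_zero, zero_mul]
    positivity
  have he0 : 0 ≤ e := by
    obtain ⟨γ, hγ⟩ := hne
    exact (norm_nonneg _).trans (hper γ hγ)
  -- each `F · φ(· − γ)` is integrable on `[T, 2T]`
  have hFφ : ∀ γ : ℝ, IntegrableOn (fun t ↦ F t * φ (t - γ)) (Icc T (2 * T)) := fun γ ↦
    (hF.mul (hφc.comp (continuous_id.sub continuous_const)).continuousOn).integrableOn_Icc
  have hFG : IntegrableOn (fun t ↦ F t * G t) (Icc T (2 * T)) :=
    (hF.mul hGc.continuousOn).integrableOn_Icc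
  -- `Σ_γ ∫ F φ(· − γ) = ∫ F G`
  have hsum : ∑ γ ∈ S₀, ∫ t in Icc T (2 * T), F t * φ (t - γ) =
      ∫ t in Icc T (2 * T), F t * G t := by
    rw [← integral_finsetSum _ fun γ _ ↦ hFφ γ]
    congr 1
    funext t
    simp only [hG, Finset.mul_sum]
  -- `‖n − ∫ F G‖ ≤ n e`
  have htri : ‖(n : ℂ) - ∫ t in Icc T (2 * T), F t * G t‖ ≤ n * e := by
    have : (n : ℂ) - ∫ t in Icc T (2 * T), F t * G t =
        ∑ γ ∈ S₀, ((1 : ℂ) - ∫ t in Icc T (2 * T), F t * φ (t - γ)) := by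
      rw [Finset.sum_sub_distrib, hsum]
      simp [hn]
    rw [this]
    calc ‖∑ γ ∈ S₀, ((1 : ℂ) - ∫ t in Icc T (2 * T), F t * φ (t - γ))‖
        ≤ ∑ γ ∈ S₀, ‖(1 : ℂ) - ∫ t in Icc T (2 * T), F t * φ (t - γ)‖ := norm_sum_le _ _
      _ ≤ ∑ γ ∈ S₀, e := Finset.sum_le_sum hper
      _ = n * e := by rw [Finset.sum_const, nsmul_eq_mul, hn]
  have hlow : n * (1 - e) ≤ ‖∫ t in Icc T (2 * T), F t * G t‖ := by
    have h1 : ‖(n : ℂ)‖ = n := by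
      rw [Complex.norm_real, Real.norm_eq_abs, abs_of_nonneg (by positivity)]
    have := norm_sub_norm_le (n : ℂ) (∫ t in Icc T (2 * T), F t * G t)
    rw [h1] at this
    linarith
  -- Cauchy–Schwarz
  have hu2 : IntegrableOn (fun t ↦ ‖F t‖ ^ 2) (Icc T (2 * T)) := (hF.norm.pow 2).integrableOn_Icc
  have hv2 : IntegrableOn (fun t ↦ ‖G t‖ ^ 2) (Icc T (2 * T)) :=
    (hGc.norm.pow 2).continuousOn.integrableOn_Icc
  have huv : IntegrableOn (fun t ↦ ‖F t‖ * ‖G t‖) (Icc T (2 * T)) :=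
    (hF.norm.mul hGc.norm.continuousOn).integrableOn_Icc
  have hCS : ‖∫ t in Icc T (2 * T), F t * G t‖ ≤ Real.sqrt IF * Real.sqrt (K * n) := by
    calc ‖∫ t in Icc T (2 * T), F t * G t‖ ≤ ∫ t in Icc T (2 * T), ‖F t‖ * ‖G t‖ := by
          refine (norm_integral_le_integral_norm _).trans (le_of_eq ?_)
          congr 1; funext t; exact norm_mul _ _
      _ ≤ Real.sqrt IF * Real.sqrt (∫ t in Icc T (2 * T), ‖G t‖ ^ 2) :=
          setIntegral_mul_le_sqrt_mul_sqrt hu2 hv2 huv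
      _ ≤ Real.sqrt IF * Real.sqrt (K * n) := by
          gcongr
          calc ∫ t in Icc T (2 * T), ‖G t‖ ^ 2 ≤ ∫ t, ‖G t‖ ^ 2 :=
                setIntegral_le_integral hGint (Eventually.of_forall fun t ↦ sq_nonneg _)
            _ ≤ K * n := hLS
  -- square and divide by `n ≥ 1`
  have hn1 : 1 ≤ n := by
    rw [hn]; exact_mod_cast Finset.card_pos.2 hne
  have hmain : n * (1 - e) ≤ Real.sqrt IF * Real.sqrt (K * n) := hlow.trans hCS
  have hsq : (n * (1 - e)) ^ 2 ≤ IF * (K * n) := by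
    have h0 : 0 ≤ n * (1 - e) := by positivity
    calc (n * (1 - e)) ^ 2 ≤ (Real.sqrt IF * Real.sqrt (K * n)) ^ 2 := pow_le_pow_left₀ h0 hmain 2
      _ = IF * (K * n) := by
          rw [mul_pow, Real.sq_sqrt hIF0, Real.sq_sqrt (by positivity)]
  have : n * (n * (1 - e) ^ 2) ≤ n * (K * IF) := by nlinarith
  exact le_of_mul_le_mul_left this (by linarith)


/-! ## The Dirichlet polynomials of §3 -/

/-- The Bombieri–Friedlander approximant `Z(t) = Σ_{m ≤ X} w(m/X) m^{-½-it}` of `ζ(½+it)`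
(Lemma 2 with `X = T^{1+η}`). [cite: Radziwill2012, §3] -/
def zetaApprox (w : ℝ → ℝ) (X : ℝ) (t : ℝ) : ℂ :=
  ∑ m ∈ Finset.Icc 1 ⌊X⌋₊, (w (m / X) : ℂ) * (m : ℂ) ^ (-(1 / 2 + t * I))

/-- The mollifier on the critical line, `M(½ + it) = Σ_{n ≤ N} a(n) n^{-½-it}`.
[cite: Radziwill2012, (1)] -/
def mollifierLine (a : ℕ → ℂ) (N : ℕ) (t : ℝ) : ℂ := dirichletMollifier a N (1 / 2 + t * I)

/-- The phase `e^{-iνt}`. [folklore] -/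
def linePhase (ν t : ℝ) : ℂ := cexp (-(↑(ν * t) * I))

/-- The amplitude `n^{-½}` as a complex number. [folklore] -/
def halfPow (n : ℕ) : ℂ := (((n : ℝ) ^ (-(1 / 2 : ℝ)) : ℝ) : ℂ)

/-- `‖e^{-iνt}‖ = 1`. [folklore] -/
theorem norm_linePhase (ν t : ℝ) : ‖linePhase ν t‖ = 1 := by
  unfold linePhase
  rw [show -(((ν * t : ℝ) : ℂ) * I) = ((-(ν * t) : ℝ) : ℂ) * I by push_cast; ring]
  exact Complex.norm_exp_ofReal_mul_I _

/-- `e^{-i(ν+ν')t} = e^{-iνt} e^{-iν't}`. [folklore] -/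
theorem linePhase_add (ν ν' t : ℝ) : linePhase (ν + ν') t = linePhase ν t * linePhase ν' t := by
  unfold linePhase
  rw [← Complex.exp_add]
  congr 1
  push_cast
  ring

/-- `e^{-i·0·t} = 1`. [folklore] -/
theorem linePhase_zero (t : ℝ) : linePhase 0 t = 1 := by
  simp [linePhase]

/-- The phase is continuous in `t`. [folklore] -/
theorem continuous_linePhase (ν : ℝ) : Continuous (linePhase ν) := by
  unfold linePhase
  fun_prop

/-- `‖n^{-½}‖ ≤ 1` for `n ≥ 1`. [folklore] -/
theorem norm_halfPow_le {n : ℕ} (hn : n ≠ 0) : ‖halfPow n‖ ≤ 1 := by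
  unfold halfPow
  rw [Complex.norm_real, Real.norm_eq_abs, abs_of_nonneg (Real.rpow_nonneg (Nat.cast_nonneg n) _)]
  exact Real.rpow_le_one_of_one_le_of_nonpos (by exact_mod_cast Nat.pos_of_ne_zero hn)
    (by norm_num)

/-- `n^{-(½+it)} = n^{-½} · e^{-it log n}` for `n ≥ 1`. [folklore] -/
theorem natCast_cpow_neg_half_line {n : ℕ} (hn : n ≠ 0) (t : ℝ) :
    (n : ℂ) ^ (-(1 / 2 + t * I)) = halfPow n * linePhase (Real.log n) t := by
  have hn0 : (0 : ℝ) < n := by exact_mod_cast Nat.pos_of_ne_zero hn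
  unfold linePhase halfPow
  rw [Complex.cpow_def_of_ne_zero (by exact_mod_cast hn), ← Complex.ofReal_natCast,
    ← Complex.ofReal_log hn0.le, Real.rpow_def_of_pos hn0, Complex.ofReal_exp, ← Complex.exp_add]
  congr 1
  push_cast
  ring

/-- `‖n^{-(½+it)}‖ ≤ 1` for `n ≥ 1`. [folklore] -/
theorem norm_natCast_cpow_neg_half_line_le {n : ℕ} (hn : n ≠ 0) (t : ℝ) :
    ‖(n : ℂ) ^ (-(1 / 2 + t * I))‖ ≤ 1 := by
  rw [natCast_cpow_neg_half_line hn t, norm_mul, norm_linePhase, mul_one]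
  exact norm_halfPow_le hn

/-- `|M(½+it)| ≤ Σ_{n ≤ N} |a(n)|`. [folklore] -/
theorem norm_mollifierLine_le (a : ℕ → ℂ) (N : ℕ) (t : ℝ) :
    ‖mollifierLine a N t‖ ≤ ∑ n ∈ Finset.Icc 1 N, ‖a n‖ := by
  unfold mollifierLine dirichletMollifier
  refine (norm_sum_le _ _).trans (Finset.sum_le_sum fun n hn ↦ ?_)
  rw [Finset.mem_Icc] at hn
  rw [norm_mul]
  calc ‖a n‖ * ‖(n : ℂ) ^ (-(1 / 2 + (t : ℂ) * I))‖ ≤ ‖a n‖ * 1 := by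
        gcongr; exact norm_natCast_cpow_neg_half_line_le (by omega) t
    _ = ‖a n‖ := mul_one _

/-- `|Z(t)| ≤ X` when `0 ≤ w ≤ 1` and `X ≥ 0`. [folklore] -/
theorem norm_zetaApprox_le {w : ℝ → ℝ} (hw : ∀ x, 0 ≤ w x ∧ w x ≤ 1) {X : ℝ} (hX : 0 ≤ X)
    (t : ℝ) : ‖zetaApprox w X t‖ ≤ X := by
  unfold zetaApprox
  calc ‖∑ m ∈ Finset.Icc 1 ⌊X⌋₊, (w (m / X) : ℂ) * (m : ℂ) ^ (-(1 / 2 + (t : ℂ) * I))‖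
      ≤ ∑ m ∈ Finset.Icc 1 ⌊X⌋₊, (1 : ℝ) := by
        refine (norm_sum_le _ _).trans (Finset.sum_le_sum fun m hm ↦ ?_)
        rw [Finset.mem_Icc] at hm
        rw [norm_mul, Complex.norm_real, Real.norm_eq_abs, abs_of_nonneg (hw _).1]
        calc w (m / X) * ‖(m : ℂ) ^ (-(1 / 2 + (t : ℂ) * I))‖ ≤ 1 * 1 := by
              gcongr
              · exact (hw _).2
              · exact norm_natCast_cpow_neg_half_line_le (by omega) t
          _ = 1 := mul_one _
    _ = ⌊X⌋₊ := by simp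
    _ ≤ X := Nat.floor_le hX

/-- `M` is continuous in `t`. [folklore] -/
theorem continuous_mollifierLine (a : ℕ → ℂ) (N : ℕ) : Continuous (mollifierLine a N) := by
  have h : mollifierLine a N = fun t ↦ ∑ n ∈ Finset.Icc 1 N,
      a n * (halfPow n * linePhase (Real.log n) t) := by
    funext t
    unfold mollifierLine dirichletMollifier
    refine Finset.sum_congr rfl fun n hn ↦ ?_
    rw [Finset.mem_Icc] at hn
    rw [natCast_cpow_neg_half_line (by omega)]
  rw [h]
  exact continuous_finsetSum _ fun n _ ↦ continuous_const.mul
    (continuous_const.mul (continuous_linePhase _))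

/-- `Z` is continuous in `t`. [folklore] -/
theorem continuous_zetaApprox (w : ℝ → ℝ) (X : ℝ) : Continuous (zetaApprox w X) := by
  have h : zetaApprox w X = fun t ↦ ∑ m ∈ Finset.Icc 1 ⌊X⌋₊,
      (w (m / X) : ℂ) * (halfPow m * linePhase (Real.log m) t) := by
    funext t
    unfold zetaApprox
    refine Finset.sum_congr rfl fun m hm ↦ ?_
    rw [Finset.mem_Icc] at hm
    rw [natCast_cpow_neg_half_line (by omega)]
  rw [h]
  exact continuous_finsetSum _ fun m _ ↦ continuous_const.mul
    (continuous_const.mul (continuous_linePhase _))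

/-- `t ↦ ζ(½ + it)` is continuous. [folklore] -/
theorem continuous_riemannZeta_half_line :
    Continuous fun t : ℝ ↦ riemannZeta (1 / 2 + t * I) := by
  refine continuous_iff_continuousAt.2 fun t ↦ ?_
  have hne : (1 / 2 + (t : ℂ) * I) ≠ 1 := by
    intro h
    have := congrArg Complex.re h
    norm_num at this
  exact ContinuousAt.comp (g := riemannZeta) (f := fun t : ℝ ↦ (1 / 2 : ℂ) + (t : ℂ) * I)
    (differentiableAt_riemannZeta hne).continuousAt (by fun_prop)

/-- The coefficients of the expansion of `Z·M`: `c(m, n) = w(m/X) m^{-½} a(n) n^{-½}`.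
[folklore] -/
def zmCoeff (w : ℝ → ℝ) (X : ℝ) (a : ℕ → ℂ) (m n : ℕ) : ℂ :=
  (w (m / X) : ℂ) * halfPow m * (a n * halfPow n)

/-- **The expansion of `P = 1 − Z·M` as a trigonometric sum** with frequencies `log m + log n`:
`P(t) = 1 − Σ_{m ≤ X} Σ_{n ≤ N} c(m,n) e^{-it(log m + log n)}`. [folklore] -/
theorem one_sub_zetaApprox_mul_mollifierLine (w : ℝ → ℝ) (X : ℝ) (a : ℕ → ℂ) (N : ℕ)
    (t : ℝ) :
    1 - zetaApprox w X t * mollifierLine a N t =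
      1 - ∑ m ∈ Finset.Icc 1 ⌊X⌋₊, ∑ n ∈ Finset.Icc 1 N,
        zmCoeff w X a m n * linePhase (Real.log m + Real.log n) t := by
  congr 1
  unfold zetaApprox mollifierLine dirichletMollifier
  rw [Finset.sum_mul]
  refine Finset.sum_congr rfl fun m hm ↦ ?_
  rw [Finset.mul_sum]
  refine Finset.sum_congr rfl fun n hn ↦ ?_
  rw [Finset.mem_Icc] at hm hn
  rw [natCast_cpow_neg_half_line (by omega), natCast_cpow_neg_half_line (by omega),
    linePhase_add, zmCoeff]
  ring

/-- **Lemma 1 applied to `P = 1 − Z·M`** (the displays of §3 before (equation2)): if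
`f(0) = 1` and `f((log m + log n)/2π) = 1` for all `m ≤ X`, `n ≤ N`, then
`P(u) = ∫ P(t) f̂(t − u) dt` for every real `u`. [cite: Radziwill2012, §3] -/
theorem integral_oneSubZM_mul_fourierInv_sub (f : 𝓢(ℝ, ℂ)) (hf0 : f 0 = 1) (w : ℝ → ℝ)
    (X : ℝ) (a : ℕ → ℂ) (N : ℕ)
    (hf1 : ∀ m ∈ Finset.Icc 1 ⌊X⌋₊, ∀ n ∈ Finset.Icc 1 N,
      f ((Real.log m + Real.log n) / (2 * π)) = 1) (u : ℝ) :
    ∫ t : ℝ, (1 - zetaApprox w X t * mollifierLine a N t) * 𝓕⁻ (f : ℝ → ℂ) (t - u) =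
      1 - zetaApprox w X u * mollifierLine a N u := by
  set φ : ℝ → ℂ := fun t ↦ 𝓕⁻ (f : ℝ → ℂ) (t - u) with hφ
  have hφi : Integrable φ := by
    have h1 : Integrable (𝓕⁻ (f : ℝ → ℂ)) := by
      rw [← SchwartzMap.fourierInv_coe]; exact (𝓕⁻ f).integrable
    exact h1.comp_sub_right u
  set c : ℕ → ℕ → ℂ := zmCoeff w X a with hc
  -- Lemma 1, one frequency at a time
  have hL1 : ∀ ν : ℝ, ∫ t : ℝ, linePhase ν t * φ t = linePhase ν u * f (ν / (2 * π)) :=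
    fun ν ↦ integral_cexp_mul_fourierInv_sub f ν u
  have hphase : ∀ ν : ℝ, Integrable fun t ↦ linePhase ν t * φ t := fun ν ↦
    hφi.bdd_mul (continuous_linePhase _).aestronglyMeasurable
      (Eventually.of_forall fun t ↦ (norm_linePhase _ t).le)
  have hterm : ∀ m n : ℕ, Integrable fun t ↦
      c m n * linePhase (Real.log m + Real.log n) t * φ t := by
    intro m n
    simpa only [mul_assoc] using (hphase (Real.log m + Real.log n)).const_mul (c m n)
  have hexp : (fun t : ℝ ↦ (1 - zetaApprox w X t * mollifierLine a N t) * φ t) = fun t ↦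
      (linePhase 0 t * φ t - ∑ m ∈ Finset.Icc 1 ⌊X⌋₊, ∑ n ∈ Finset.Icc 1 N,
        c m n * linePhase (Real.log m + Real.log n) t * φ t) := by
    funext t
    rw [one_sub_zetaApprox_mul_mollifierLine, sub_mul, Finset.sum_mul, linePhase_zero]
    congr 1
    exact Finset.sum_congr rfl fun m _ ↦ Finset.sum_mul _ _ _
  rw [hexp, integral_sub (hphase 0)
    (integrable_finsetSum _ fun m _ ↦ integrable_finsetSum _ fun n _ ↦ hterm m n),
    hL1 0, integral_finsetSum _ fun m _ ↦ integrable_finsetSum _ fun n _ ↦ hterm m n]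
  rw [Finset.sum_congr rfl fun m _ ↦ integral_finsetSum _ fun n _ ↦ hterm m n]
  have h0 : linePhase 0 u * f (0 / (2 * π)) = 1 := by rw [zero_div, hf0, linePhase_zero, one_mul]
  rw [h0, one_sub_zetaApprox_mul_mollifierLine]
  congr 1
  refine Finset.sum_congr rfl fun m hm ↦ Finset.sum_congr rfl fun n hn ↦ ?_
  simp_rw [mul_assoc]
  rw [integral_const_mul, hL1, hf1 m hm n hn, mul_one]

/-! ## The final algebra (the first display of §4) -/

/-- The bookkeeping turning `n₀ (1 − e)² ≤ K₀ T 𝓘`, `n₀ ≥ Card S − 2(ε'T/δ + 1)`,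
`K₀ = (log T/2π)(1 + θ + 1/A + η + 2/log T)`, `δ = 2πA/log T` and the smallness of `e, η, ε'`,
`1/log T`, `1/(T log T)` into `𝓘 ≥ (1−ε)/(1+θ+1/A) · Card S/((T/2π) log T) − ε`.
[cite: Radziwill2012, §4] -/
theorem propA_algebra {ε θ A T lT e η ε' n₀ cS I δ : ℝ} (hε : 0 < ε) (hε1 : ε ≤ 1)
    (hθ : 0 < θ) (hA : 0 < A) (hT : 0 < T) (hlT : 8 / ε ≤ lT) (he0 : 0 ≤ e) (he : e ≤ ε / 4)
    (hη0 : 0 ≤ η) (hη : η ≤ ε / 4) (hε'0 : 0 ≤ ε') (hε'A : 2 * ε' / A ≤ ε / 2)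
    (hTlT : 8 * π / ε ≤ T * lT) (hδ : δ = 2 * π * A / lT) (hcS : 0 ≤ cS)
    (hn₀ : cS - 2 * (ε' * T / δ + 1) ≤ n₀)
    (hstep : n₀ * (1 - e) ^ 2 ≤ lT / (2 * π) * (1 + θ + 1 / A + η + 2 / lT) * (T * I)) :
    (1 - ε) / (1 + θ + 1 / A) * (cS / (T / (2 * π) * lT)) - ε ≤ I := by
  have hπ := Real.pi_pos
  have hlT8 : 8 ≤ lT := by
    have h1 : 8 ≤ 8 / ε := by
      rw [le_div_iff₀ hε]; linarith
    linarith
  have hlT0 : 0 < lT := by linarith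
  have hA' : 0 ≤ 1 / A := by positivity
  set D : ℝ := 1 + θ + 1 / A with hD
  have hD1 : 1 ≤ D := by
    rw [hD]; linarith
  have hD0 : 0 < D := by linarith
  have h2lT : 2 / lT ≤ ε / 4 := by
    rw [div_le_iff₀ hlT0]
    rw [div_le_iff₀ hε] at hlT
    linarith
  have h2lT0 : 0 ≤ 2 / lT := by positivity
  set D' : ℝ := D + η + 2 / lT with hD'
  have hD'D : D' ≤ D + ε / 2 := by
    rw [hD']; linarith
  have hD'1 : 1 ≤ D' := by
    rw [hD']; linarith
  have hD'0 : 0 < D' := by linarith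
  -- the coefficient `c = (1 - e)² · 2π / (T · lT · D')`
  set c : ℝ := (1 - e) ^ 2 * (2 * π) / (T * lT * D') with hc
  have hc0 : 0 ≤ c := by positivity
  have he2 : e ≤ 2 := by linarith
  have he1 : (1 - e) ^ 2 ≤ 1 := by nlinarith [mul_nonneg he0 (sub_nonneg.2 he2)]
  -- from `hstep`: `I ≥ c · n₀`
  have hstep' : c * n₀ ≤ I := by
    have h1 : c * n₀ = n₀ * (1 - e) ^ 2 * ((2 * π) / (T * lT * D')) := by
      rw [hc]; ring
    have h2 : lT / (2 * π) * D' * (T * I) * ((2 * π) / (T * lT * D')) = I := by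
      field_simp
    rw [h1, ← h2]
    exact mul_le_mul_of_nonneg_right hstep (by positivity)
  -- `c · n₀ ≥ c · cS − c · 2 (ε'T/δ + 1)`
  have hlow : c * cS - c * (2 * (ε' * T / δ + 1)) ≤ c * n₀ := by
    have := mul_le_mul_of_nonneg_left hn₀ hc0
    linarith [mul_sub c cS (2 * (ε' * T / δ + 1))]
  -- the main term: `c · cS ≥ (1 - ε)/D · cS/((T/2π) lT)`
  have hkey : (1 - ε) / D ≤ (1 - e) ^ 2 / D' := by
    rw [div_le_div_iff₀ hD0 hD'0]
    have h1 : 1 - ε / 2 ≤ (1 - e) ^ 2 := by nlinarith [sq_nonneg e]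
    have hε1' : 0 ≤ 1 - ε := by linarith
    have h2 : (1 - ε) * D' ≤ (1 - ε) * (D + ε / 2) := mul_le_mul_of_nonneg_left hD'D hε1'
    have h3 : (1 - ε) * (D + ε / 2) ≤ (1 - ε / 2) * D := by
      nlinarith [mul_nonneg hε.le (by linarith : 0 ≤ D - 1 + ε)]
    have h4 : (1 - ε / 2) * D ≤ (1 - e) ^ 2 * D := mul_le_mul_of_nonneg_right h1 hD0.le
    linarith
  have hmain : (1 - ε) / D * (cS / (T / (2 * π) * lT)) ≤ c * cS := by
    have hq : 0 ≤ cS / (T / (2 * π) * lT) := by positivity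
    have hc' : c * cS = (1 - e) ^ 2 / D' * (cS / (T / (2 * π) * lT)) := by
      rw [hc]; field_simp
    rw [hc']
    exact mul_le_mul_of_nonneg_right hkey hq
  -- the loss: `c · 2(ε'T/δ + 1) ≤ ε`
  have hloss : c * (2 * (ε' * T / δ + 1)) ≤ ε := by
    have h1 : c * (2 * (ε' * T / δ + 1)) =
        (1 - e) ^ 2 / D' * (2 * ε' / A + 4 * π / (T * lT)) := by
      rw [hc, hδ]; field_simp; ring
    rw [h1]
    have h2 : 4 * π / (T * lT) ≤ ε / 2 := by
      rw [div_le_iff₀ (by positivity)]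
      rw [div_le_iff₀ hε] at hTlT
      linarith
    have h3 : 2 * ε' / A + 4 * π / (T * lT) ≤ ε := by linarith
    have h4 : (1 - e) ^ 2 / D' ≤ 1 := by
      rw [div_le_one hD'0]; linarith
    have h5 : 0 ≤ 2 * ε' / A + 4 * π / (T * lT) := by positivity
    calc (1 - e) ^ 2 / D' * (2 * ε' / A + 4 * π / (T * lT)) ≤ 1 * ε :=
          mul_le_mul h4 h3 h5 zero_le_one
      _ = ε := one_mul ε
  linarith

/-! ## Proposition A for one large `T` -/

/-- The decay constant of the plateau functions: `D_k = 2 · riseNorm k / (2π)^k`. [folklore] -/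
def plateauDecayConst (k : ℕ) : ℝ := 2 * riseNorm k / (2 * π) ^ k

/-- `0 ≤ D_k`. [folklore] -/
theorem plateauDecayConst_nonneg (k : ℕ) : 0 ≤ plateauDecayConst k := by
  unfold plateauDecayConst
  have := riseNorm_nonneg k
  positivity

/-- The decay bound in the form `‖𝓕⁻ f_L (x)‖ ≤ D_k / |x|^k`. [folklore] -/
theorem norm_fourierInv_plateau_le_decayConst {L : ℝ} (hL : 0 ≤ L) {k : ℕ} (hk : 1 ≤ k) {x : ℝ}
    (hx : x ≠ 0) : ‖𝓕⁻ (plateauFn L) x‖ ≤ plateauDecayConst k / |x| ^ k := by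
  have h := norm_fourierInv_plateau_le_div_pow hL hk hx
  rw [mul_pow] at h
  unfold plateauDecayConst
  rwa [div_div]

/-- **Proposition A at one height `T`** (the whole of §3, with the parameters and the largeness of
`T` as explicit hypotheses): given the smoothed approximation of `ζ` on `[T, 2T]` (Lemma 2 at this
`T`) and the smallness hypothesis `herr` on the three error terms, every `2πA/log T`-spaced set `S` of critical ordinates in `[T, 2T]` and every coefficient
sequence with `Σ_{n ≤ T^θ} |a(n)| ≤ Mb` satisfy
`𝓘(M_θ) ≥ (1−ε)/(1+θ+1/A) · Card S/((T/2π) log T) − ε`. [cite: Radziwill2012, §3] -/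
theorem propA_core {ε θ A η ε' v Cw T Mb : ℝ} {k : ℕ} {w : ℝ → ℝ}
    (hε : 0 < ε) (hε1 : ε ≤ 1) (hθ : 0 < θ) (hA : 0 < A)
    (hη : 0 < η) (hηε : η ≤ ε / 4) (hε'0 : 0 < ε') (hε'A : 2 * ε' / A ≤ ε / 2)
    (hk : 2 ≤ k) (hw : ∀ x, 0 ≤ w x ∧ w x ≤ 1) (hCw : 0 ≤ Cw) (hMb : 0 ≤ Mb)
    (hTε : Real.exp (8 / ε) ≤ T) (hTπ : 8 * π / ε ≤ T)
    (hAFE : ∀ t ∈ Icc T (2 * T),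
      ‖riemannZeta (1 / 2 + t * I) - zetaApprox w (T ^ (1 + η)) t‖ ≤ Cw * T ^ (-v))
    (herr : Cw * T ^ (-v) * Mb
        + (1 + T ^ (1 + η) * Mb) *
            (2 * (plateauDecayConst k * (ε' * T) ^ (1 - (k : ℝ)) / ((k : ℝ) - 1)))
        + Cw * T ^ (-v) * Mb *
            (2 * ((1 + η + θ) * Real.log T / (2 * π) + 1 / π) + 2 * plateauDecayConst 2)
        ≤ ε / 4)
    (S : Finset ℝ) (hS : ∀ γ ∈ S, γ ∈ Icc T (2 * T) ∧ riemannZeta (1 / 2 + γ * I) = 0)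
    (hsep : ∀ γ ∈ S, ∀ γ' ∈ S, γ ≠ γ' → 2 * π * A / Real.log T ≤ |γ - γ'|)
    (a : ℕ → ℂ) (haMb : ∑ n ∈ Finset.Icc 1 ⌊T ^ θ⌋₊, ‖a n‖ ≤ Mb) :
    (1 - ε) / (1 + θ + 1 / A) * ((S.card : ℝ) / (T / (2 * π) * Real.log T)) - ε ≤
      mollificationDefect (dirichletMollifier a ⌊T ^ θ⌋₊) T := by
  -- basic quantities
  have hπ := Real.pi_pos
  have hε8 : 8 ≤ 8 / ε := by rw [le_div_iff₀ hε]; linarith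
  have hT8 : Real.exp 8 ≤ T := le_trans (Real.exp_le_exp.2 hε8) hTε
  have hT1 : 1 < T := lt_of_lt_of_le (by have := Real.add_one_le_exp (8 : ℝ); linarith) hT8
  have hT0 : 0 < T := by linarith
  have hlT : 8 / ε ≤ Real.log T := by
    rw [← Real.log_exp (8 / ε)]; exact Real.log_le_log (Real.exp_pos _) hTε
  have hlT8 : 8 ≤ Real.log T := hε8.trans hlT
  set lT := Real.log T with hlTdef
  have hlT0 : 0 < lT := by linarith
  have hTlT : 8 * π / ε ≤ T * lT := by
    calc 8 * π / ε ≤ T := hTπ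
      _ = T * 1 := (mul_one T).symm
      _ ≤ T * lT := by gcongr; linarith
  set N : ℕ := ⌊T ^ θ⌋₊ with hN
  set X : ℝ := T ^ (1 + η) with hX
  have hX1 : 1 ≤ X := Real.one_le_rpow hT1.le (by linarith)
  have hX0 : 0 ≤ X := by linarith
  have hTθ1 : 1 ≤ T ^ θ := Real.one_le_rpow hT1.le hθ.le
  set δ : ℝ := 2 * π * A / lT with hδ
  have hδ0 : 0 < δ := by positivity
  set L : ℝ := (1 + η + θ) * lT / (2 * π) with hL
  have hL0 : 0 ≤ L := by positivity
  -- the test function and its transform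
  set f : 𝓢(ℝ, ℂ) := plateauSchwartz L hL0 with hf
  set φ : ℝ → ℂ := 𝓕⁻ (plateauFn L) with hφdef
  have hφcoe : ((𝓕⁻ f : 𝓢(ℝ, ℂ)) : ℝ → ℂ) = φ := by
    rw [SchwartzMap.fourierInv_coe]; rfl
  have hφc : Continuous φ := by rw [← hφcoe]; exact (𝓕⁻ f).continuous
  have hφi : Integrable φ := by rw [← hφcoe]; exact (𝓕⁻ f).integrable
  have hφ2 : Integrable fun t ↦ ‖φ t‖ ^ 2 := by
    rw [← hφcoe]
    have := (𝓕⁻ f).memLp 2 volume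
    simpa using this.integrable_norm_pow (by norm_num)
  have hφB : ∀ x, ‖φ x‖ ≤ L + 1 / π := fun x ↦ norm_fourierInv_plateau_le_length hL0 x
  have hφk : ∀ x, x ≠ 0 → ‖φ x‖ ≤ plateauDecayConst k / |x| ^ k := fun x hx ↦
    norm_fourierInv_plateau_le_decayConst hL0 (by omega) hx
  have hφ2' : ∀ x, x ≠ 0 → ‖φ x‖ ≤ plateauDecayConst 2 / |x| ^ 2 := fun x hx ↦
    norm_fourierInv_plateau_le_decayConst hL0 (by norm_num) hx
  have hΦ₁ : ∫ x, ‖φ x‖ ≤ 2 * (L + 1 / π) + 2 * plateauDecayConst 2 := by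
    have := integral_norm_le_of_decay hφi (le_refl 2) hφB hφ2'
    norm_num at this
    rw [one_div]
    exact this
  set R : ℝ := ε' * T with hR
  have hR0 : 0 < R := by positivity
  have hk1 : (0 : ℝ) < (k : ℝ) - 1 := by
    have : (2 : ℝ) ≤ k := by exact_mod_cast hk
    linarith
  have hΦt : ∫ x in {x : ℝ | R ≤ |x|}, ‖φ x‖ ≤
      2 * (plateauDecayConst k * R ^ (1 - (k : ℝ)) / ((k : ℝ) - 1)) :=
    setIntegral_norm_le_of_decay hφi hk hφk hR0
  -- the Dirichlet polynomials
  set Z : ℝ → ℂ := zetaApprox w X with hZ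
  set M : ℝ → ℂ := mollifierLine a N with hM
  set P : ℝ → ℂ := fun t ↦ 1 - Z t * M t with hP
  set F : ℝ → ℂ := fun t ↦ 1 - riemannZeta (1 / 2 + t * I) * M t with hF
  have hMb' : ∀ t, ‖M t‖ ≤ Mb := fun t ↦ (norm_mollifierLine_le a N t).trans haMb
  have hZX : ∀ t, ‖Z t‖ ≤ X := fun t ↦ norm_zetaApprox_le hw hX0 t
  have hPmax : ∀ t, ‖P t‖ ≤ 1 + X * Mb := by
    intro t
    calc ‖P t‖ ≤ ‖(1 : ℂ)‖ + ‖Z t * M t‖ := norm_sub_le _ _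
      _ ≤ 1 + X * Mb := by
          rw [norm_one, norm_mul]
          exact add_le_add le_rfl (mul_le_mul (hZX t) (hMb' t) (norm_nonneg _) hX0)
  have hPc : Continuous P :=
    continuous_const.sub ((continuous_zetaApprox w X).mul (continuous_mollifierLine a N))
  have hFc : Continuous F :=
    continuous_const.sub (continuous_riemannZeta_half_line.mul (continuous_mollifierLine a N))
  have hPF : ∀ t ∈ Icc T (2 * T), ‖P t - F t‖ ≤ Cw * T ^ (-v) * Mb := by
    intro t ht
    have : P t - F t = (riemannZeta (1 / 2 + t * I) - Z t) * M t := by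
      simp only [hP, hF]; ring
    rw [this, norm_mul]
    exact mul_le_mul (hAFE t ht) (hMb' t) (norm_nonneg _) (by positivity)
  -- the reproducing identity (Lemma 1)
  have hf0 : f 0 = 1 := by
    rw [hf, plateauSchwartz_apply]
    exact plateauFn_eq_one ⟨le_rfl, hL0⟩
  have hf1 : ∀ m ∈ Finset.Icc 1 ⌊X⌋₊, ∀ n ∈ Finset.Icc 1 N,
      f ((Real.log m + Real.log n) / (2 * π)) = 1 := by
    intro m hm n hn
    rw [Finset.mem_Icc] at hm hn
    rw [hf, plateauSchwartz_apply]
    apply plateauFn_eq_one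
    have hm0 : (0 : ℝ) < m := by exact_mod_cast hm.1
    have hn0 : (0 : ℝ) < n := by exact_mod_cast hn.1
    have hlm : Real.log m ≤ (1 + η) * lT := by
      have : (m : ℝ) ≤ X := le_trans (by exact_mod_cast hm.2) (Nat.floor_le hX0)
      calc Real.log m ≤ Real.log X := Real.log_le_log hm0 this
        _ = (1 + η) * lT := by rw [hX, Real.log_rpow hT0]
    have hln : Real.log n ≤ θ * lT := by
      have : (n : ℝ) ≤ T ^ θ := le_trans (by exact_mod_cast hn.2) (Nat.floor_le (by positivity))
      calc Real.log n ≤ Real.log (T ^ θ) := Real.log_le_log hn0 this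
        _ = θ * lT := by rw [Real.log_rpow hT0]
    constructor
    · exact div_nonneg (add_nonneg (Real.log_nonneg (by exact_mod_cast hm.1))
        (Real.log_nonneg (by exact_mod_cast hn.1))) (by positivity)
    · rw [hL]
      apply div_le_div_of_nonneg_right _ (by positivity)
      nlinarith
  have hrep : ∀ u : ℝ, ∫ t, P t * φ (t - u) = P u := fun u ↦
    integral_oneSubZM_mul_fourierInv_sub f hf0 w X a N hf1 u
  -- the inner zeros and the estimate at each of them
  set Sin : Finset ℝ := S.filter fun γ ↦ T + R ≤ γ ∧ γ ≤ 2 * T - R with hSin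
  set e : ℝ := Cw * T ^ (-v) * Mb
      + (1 + X * Mb) * (2 * (plateauDecayConst k * R ^ (1 - (k : ℝ)) / ((k : ℝ) - 1)))
      + Cw * T ^ (-v) * Mb * (2 * (L + 1 / π) + 2 * plateauDecayConst 2) with he_def
  have he_le : e ≤ ε / 4 := herr
  have he0 : 0 ≤ e := by
    have h1 : 0 ≤ Cw * T ^ (-v) * Mb := by positivity
    have h2 : 0 ≤ (1 + X * Mb) * (2 * (plateauDecayConst k * R ^ (1 - (k : ℝ)) / ((k : ℝ) - 1))) := by
      apply mul_nonneg (by positivity)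
      apply mul_nonneg zero_le_two
      exact div_nonneg (mul_nonneg (plateauDecayConst_nonneg k) (Real.rpow_nonneg hR0.le _)) hk1.le
    have h3 : 0 ≤ Cw * T ^ (-v) * Mb * (2 * (L + 1 / π) + 2 * plateauDecayConst 2) := by
      have := plateauDecayConst_nonneg 2
      positivity
    linarith
  have hper : ∀ γ ∈ Sin, ‖1 - ∫ t in Icc T (2 * T), F t * φ (t - γ)‖ ≤ e := by
    intro γ hγ
    rw [hSin, Finset.mem_filter] at hγ
    obtain ⟨hγS, hγ1, hγ2⟩ := hγ
    have hγI : γ ∈ Icc (T + R) (2 * T - R) := ⟨hγ1, hγ2⟩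
    have hζ := (hS γ hγS).2
    have hPγ : ‖P γ - 1‖ ≤ Cw * T ^ (-v) * Mb := by
      have : P γ - 1 = (riemannZeta (1 / 2 + γ * I) - Z γ) * M γ := by
        simp only [hP]; rw [hζ]; ring
      rw [this, norm_mul]
      exact mul_le_mul (hAFE γ (hS γ hγS).1) (hMb' γ) (norm_nonneg _) (by positivity)
    exact norm_one_sub_setIntegral_le hT0 hR0.le hFc.continuousOn hPc hφc hφi hPmax hPF hΦ₁
      hΦt hrep hγI hPγ
  -- Lemmas 3–4 for the inner zeros
  have hsepin : ∀ γ ∈ Sin, ∀ γ' ∈ Sin, γ ≠ γ' → δ ≤ |γ - γ'| := fun γ hγ γ' hγ' hne ↦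
    hsep γ (Finset.mem_of_mem_filter γ hγ) γ' (Finset.mem_of_mem_filter γ' hγ') hne
  have h2π : 0 < 1 / (2 * π) := by positivity
  have hαβ : -(1 / (2 * π)) ≤ L + 1 / (2 * π) := by linarith
  have hLS' : ∫ t, ‖∑ γ ∈ Sin, φ (t - γ)‖ ^ 2 ≤
      (L + 1 / (2 * π) - -(1 / (2 * π)) + 1 / δ) * Sin.card :=
    integral_norm_sq_sum_fourierInv_sub_le f hαβ (fun x hx ↦ plateauFn_eq_zero hL0 hx)
      (fun x ↦ norm_plateauFn_le L x hL0) Sin hδ0 hsepin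
  have hK : L + 1 / (2 * π) - -(1 / (2 * π)) + 1 / δ =
      lT / (2 * π) * (1 + θ + 1 / A + η + 2 / lT) := by
    rw [hL, hδ]; field_simp; ring
  rw [hK] at hLS'
  have hK0 : 0 ≤ lT / (2 * π) * (1 + θ + 1 / A + η + 2 / lT) := by positivity
  -- integrability of `|Σ_γ φ(· − γ)|²`
  have hGint : Integrable fun t ↦ ‖∑ γ ∈ Sin, φ (t - γ)‖ ^ 2 := by
    apply Integrable.mono' (g := fun t ↦ (Sin.card : ℝ) * ∑ γ ∈ Sin, ‖φ (t - γ)‖ ^ 2)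
    · exact (integrable_finsetSum _ fun γ _ ↦ hφ2.comp_sub_right γ).const_mul _
    · exact ((continuous_finsetSum _ fun γ _ ↦
        hφc.comp (continuous_id.sub continuous_const)).norm.pow 2).aestronglyMeasurable
    · filter_upwards with t
      rw [Real.norm_eq_abs, abs_of_nonneg (sq_nonneg _)]
      calc ‖∑ γ ∈ Sin, φ (t - γ)‖ ^ 2 ≤ (∑ γ ∈ Sin, ‖φ (t - γ)‖) ^ 2 :=
            pow_le_pow_left₀ (norm_nonneg _) (norm_sum_le _ _) 2
        _ = (∑ γ ∈ Sin, 1 * ‖φ (t - γ)‖) ^ 2 := by simp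
        _ ≤ (∑ γ ∈ Sin, (1 : ℝ) ^ 2) * ∑ γ ∈ Sin, ‖φ (t - γ)‖ ^ 2 :=
            Finset.sum_mul_sq_le_sq_mul_sq _ _ _
        _ = Sin.card * ∑ γ ∈ Sin, ‖φ (t - γ)‖ ^ 2 := by simp
  -- summing over the inner zeros and Cauchy–Schwarz
  have hstep := card_mul_sq_le_of_forall_norm_one_sub_le hFc.continuousOn hφc Sin
    (by linarith : e ≤ 1) hK0 hper hGint hLS'
  have hIF : ∫ t in Icc T (2 * T), ‖F t‖ ^ 2 =
      T * mollificationDefect (dirichletMollifier a N) T := by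
    unfold mollificationDefect
    rw [intervalIntegral.integral_of_le (by linarith), integral_Icc_eq_integral_Ioc, ← mul_assoc,
      mul_inv_cancel₀ hT0.ne', one_mul]
    simp only [hF, hM, mollifierLine]
  rw [hIF] at hstep
  -- counting the zeros near the edges
  set S₁ : Finset ℝ := S.filter fun γ ↦ γ < T + R with hS₁
  set S₂ : Finset ℝ := S.filter fun γ ↦ 2 * T - R < γ with hS₂
  have hcover : S ⊆ Sin ∪ (S₁ ∪ S₂) := by
    intro γ hγ
    simp only [Finset.mem_union, hSin, hS₁, hS₂, Finset.mem_filter]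
    by_cases h1 : γ < T + R
    · exact Or.inr (Or.inl ⟨hγ, h1⟩)
    · by_cases h2 : 2 * T - R < γ
      · exact Or.inr (Or.inr ⟨hγ, h2⟩)
      · exact Or.inl ⟨hγ, le_of_not_gt h1, le_of_not_gt h2⟩
  have hcard : (S.card : ℝ) ≤ Sin.card + (S₁.card + S₂.card) := by
    have h : S.card ≤ Sin.card + (S₁.card + S₂.card) :=
      (Finset.card_le_card hcover).trans
        ((Finset.card_union_le _ _).trans (add_le_add le_rfl (Finset.card_union_le _ _)))
    exact_mod_cast h
  have hS₁c : ((S₁.card : ℝ) - 1) * δ ≤ (T + R) - T := by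
    apply card_sub_one_mul_le_of_separated hδ0 (by linarith)
    · intro γ hγ
      rw [hS₁, Finset.mem_filter] at hγ
      exact ⟨(hS γ hγ.1).1.1, hγ.2.le⟩
    · intro γ hγ γ' hγ' hne
      exact hsep γ (Finset.mem_of_mem_filter γ hγ) γ' (Finset.mem_of_mem_filter γ' hγ') hne
  have hS₂c : ((S₂.card : ℝ) - 1) * δ ≤ 2 * T - (2 * T - R) := by
    apply card_sub_one_mul_le_of_separated hδ0 (by linarith)
    · intro γ hγ
      rw [hS₂, Finset.mem_filter] at hγ
      exact ⟨hγ.2.le, (hS γ hγ.1).1.2⟩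
    · intro γ hγ γ' hγ' hne
      exact hsep γ (Finset.mem_of_mem_filter γ hγ) γ' (Finset.mem_of_mem_filter γ' hγ') hne
  have hn₀ : (S.card : ℝ) - 2 * (ε' * T / δ + 1) ≤ Sin.card := by
    have h1 : (S₁.card : ℝ) ≤ R / δ + 1 := by
      rw [div_add_one hδ0.ne', le_div_iff₀ hδ0]; linarith
    have h2 : (S₂.card : ℝ) ≤ R / δ + 1 := by
      rw [div_add_one hδ0.ne', le_div_iff₀ hδ0]; linarith
    rw [hR] at h1 h2
    linarith
  -- the final algebra
  have hI0 : 0 ≤ mollificationDefect (dirichletMollifier a N) T := by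
    unfold mollificationDefect
    apply mul_nonneg (inv_nonneg.2 hT0.le)
    exact intervalIntegral.integral_nonneg (by linarith) fun t _ ↦ sq_nonneg _
  exact propA_algebra hε hε1 hθ hA hT0 hlT he0 he_le hη.le hηε hε'0.le hε'A hTlT hδ
    (Nat.cast_nonneg _) hn₀ hstep

/-! ## Proposition A -/

/-- `𝓘 ≥ 0`. [folklore] -/
theorem mollificationDefect_nonneg (M : ℂ → ℂ) {T : ℝ} (hT : 0 < T) :
    0 ≤ mollificationDefect M T := by
  unfold mollificationDefect
  apply mul_nonneg (inv_nonneg.2 hT.le)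
  exact intervalIntegral.integral_nonneg (by linarith) fun t _ ↦ sq_nonneg _

/-- **Radziwiłł 2012, Proposition A, deduced from Lemma 2 (Bombieri–Friedlander)** — the
argument of §3, with Lemma 1, the large-sieve step of Lemmas 3–4 and the test function proved in
the sibling files. Parameters: `η = ε/4`, margins `ε'T` with
`ε' = εA/4`, `v = 2θ + 3`, `k = ⌈2θ⌉ + 4`; all three error terms are then `≤ K/T` for an explicit
`K = K(ε, θ, A, C, w)`, and `T₀ = max(T₂, e^{8/ε}, 8π/ε, 4K/ε + 1)`.
[cite: Radziwill2012, Proposition A] -/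
theorem Radziwill2012_propA_of_lemma2 (h2 : Radziwill2012_lemma2) : Radziwill2012_propA := by
  intro ε hε θ hθ A hA C
  have hπ := Real.pi_pos
  -- the case `ε > 1` is trivial: the claimed lower bound is negative
  rcases lt_or_ge 1 ε with hε1 | hε1
  · refine ⟨2, fun T hT S _ _ a _ _ ↦ ?_⟩
    have hT0 : 0 < T := by linarith
    have hlog : 0 < Real.log T := Real.log_pos (by linarith)
    have hI0 := mollificationDefect_nonneg (dirichletMollifier a ⌊T ^ θ⌋₊) hT0
    have h1 : (1 - ε) / (1 + θ + 1 / A) * ((S.card : ℝ) / (T / (2 * π) * Real.log T)) ≤ 0 := by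
      apply mul_nonpos_of_nonpos_of_nonneg
      · exact div_nonpos_of_nonpos_of_nonneg (by linarith) (by positivity)
      · positivity
    linarith
  -- parameters
  set η : ℝ := ε / 4 with hη
  have hη0 : 0 < η := by positivity
  have hη1 : η ≤ 1 := by rw [hη]; linarith
  set ε' : ℝ := ε * A / 4 with hε'
  have hε'0 : 0 < ε' := by positivity
  have hε'A : 2 * ε' / A ≤ ε / 2 := by
    rw [hε']; apply le_of_eq; field_simp; ring
  set v : ℝ := 2 * θ + 3 with hv
  set k : ℕ := ⌈2 * θ⌉₊ + 4 with hk
  have hk2 : 2 ≤ k := by omega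
  have hkθ : 2 * θ + 3 ≤ (k : ℝ) - 1 := by
    rw [hk]; push_cast; have := Nat.le_ceil (2 * θ); linarith
  have hk1 : (0 : ℝ) < (k : ℝ) - 1 := by linarith
  obtain ⟨w, _, hw01, _, Cw, T₂, hAFE⟩ := h2 η hη0 v (by positivity)
  set Cw' : ℝ := max Cw 0 with hCw'
  have hCw'0 : 0 ≤ Cw' := le_max_right _ _
  set C₁ : ℝ := max (C 1) 0 with hC₁
  have hC₁0 : 0 ≤ C₁ := le_max_right _ _
  set D2 : ℝ := plateauDecayConst 2 with hD2
  set Dk : ℝ := plateauDecayConst k with hDk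
  have hD20 : 0 ≤ D2 := plateauDecayConst_nonneg 2
  have hDk0 : 0 ≤ Dk := plateauDecayConst_nonneg k
  set cst : ℝ := (3 + θ) / π + 2 / π + 2 * D2 with hcst
  have hcst0 : 0 ≤ cst := by positivity
  set Kc : ℝ := Cw' * C₁ + Cw' * C₁ * cst + 2 * Dk * ε' ^ (1 - (k : ℝ)) * (1 + C₁) / ((k : ℝ) - 1)
    with hKc
  have hKc0 : 0 ≤ Kc := by
    have : 0 ≤ 2 * Dk * ε' ^ (1 - (k : ℝ)) * (1 + C₁) / ((k : ℝ) - 1) :=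
      div_nonneg (by positivity) hk1.le
    positivity
  refine ⟨max (max T₂ (Real.exp (8 / ε))) (max (8 * π / ε) (4 * Kc / ε + 1)),
    fun T hT S hS hsep a _ ha ↦ ?_⟩
  have hT₂ : T₂ ≤ T := le_trans (le_trans (le_max_left _ _) (le_max_left _ _)) hT
  have hTε : Real.exp (8 / ε) ≤ T := le_trans (le_trans (le_max_right _ _) (le_max_left _ _)) hT
  have hTπ : 8 * π / ε ≤ T := le_trans (le_trans (le_max_left _ _) (le_max_right _ _)) hT
  have hTK : 4 * Kc / ε ≤ T := by
    have := le_trans (le_trans (le_max_right _ _) (le_max_right _ _)) hT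
    linarith
  have hT1 : 1 ≤ T := by
    have h1 := Real.add_one_le_exp (8 / ε)
    have h2 : 0 ≤ 8 / ε := by positivity
    linarith
  have hT0 : 0 < T := by linarith
  -- the bound `Mb` for `Σ |a(n)|`
  set N : ℕ := ⌊T ^ θ⌋₊ with hN
  have hTθ0 : 0 ≤ T ^ θ := by positivity
  set Mb : ℝ := C₁ * (T ^ θ) ^ 2 with hMb
  have hMb0 : 0 ≤ Mb := by positivity
  have haMb : ∑ n ∈ Finset.Icc 1 N, ‖a n‖ ≤ Mb := by
    calc ∑ n ∈ Finset.Icc 1 N, ‖a n‖ ≤ ∑ n ∈ Finset.Icc 1 N, C₁ * T ^ θ := by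
          refine Finset.sum_le_sum fun n hn ↦ ?_
          rw [Finset.mem_Icc] at hn
          have h1 := ha 1 one_pos n hn.1
          rw [Real.rpow_one] at h1
          have hnT : (n : ℝ) ≤ T ^ θ := le_trans (by exact_mod_cast hn.2) (Nat.floor_le hTθ0)
          calc ‖a n‖ ≤ C 1 * n := h1
            _ ≤ C₁ * n := mul_le_mul_of_nonneg_right (le_max_left _ _) (Nat.cast_nonneg n)
            _ ≤ C₁ * T ^ θ := mul_le_mul_of_nonneg_left hnT hC₁0
      _ = N * (C₁ * T ^ θ) := by rw [Finset.sum_const, Nat.card_Icc, nsmul_eq_mul]; simp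
      _ ≤ T ^ θ * (C₁ * T ^ θ) := by
          apply mul_le_mul_of_nonneg_right (Nat.floor_le hTθ0) (by positivity)
      _ = Mb := by rw [hMb]; ring
  -- Lemma 2 at this `T`
  have hAFE' : ∀ t ∈ Icc T (2 * T),
      ‖riemannZeta (1 / 2 + t * I) - zetaApprox w (T ^ (1 + η)) t‖ ≤ Cw' * T ^ (-v) := by
    intro t ht
    have h := hAFE T hT₂ t ht
    unfold zetaApprox
    calc _ ≤ Cw * T ^ (-v) := h
      _ ≤ Cw' * T ^ (-v) := mul_le_mul_of_nonneg_right (le_max_left _ _) (by positivity)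
  -- powers of `T`
  have hp1 : T ^ (-v) * (T ^ θ) ^ 2 = T ^ (-3 : ℝ) := by
    rw [sq, ← Real.rpow_add hT0, ← Real.rpow_add hT0, hv]
    congr 1; ring
  have hp2 : T ^ (-3 : ℝ) ≤ T⁻¹ := by
    rw [← Real.rpow_neg_one]
    exact Real.rpow_le_rpow_of_exponent_le hT1 (by norm_num)
  have hp3 : T ^ (-3 : ℝ) * T ≤ T⁻¹ := by
    calc T ^ (-3 : ℝ) * T = T ^ (-3 : ℝ) * T ^ (1 : ℝ) := by rw [Real.rpow_one]
      _ = T ^ ((-3 : ℝ) + 1) := by rw [← Real.rpow_add hT0]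
      _ ≤ T ^ (-1 : ℝ) := Real.rpow_le_rpow_of_exponent_le hT1 (by norm_num)
      _ = T⁻¹ := Real.rpow_neg_one T
  have hp4 : T ^ (-(2 * θ + 3)) ≤ T⁻¹ := by
    rw [← Real.rpow_neg_one]
    exact Real.rpow_le_rpow_of_exponent_le hT1 (by linarith)
  have hp5 : T ^ (1 + η) * (T ^ θ) ^ 2 * T ^ (-(2 * θ + 3)) ≤ T⁻¹ := by
    rw [sq, ← Real.rpow_add hT0, ← Real.rpow_add hT0, ← Real.rpow_add hT0, ← Real.rpow_neg_one]
    exact Real.rpow_le_rpow_of_exponent_le hT1 (by linarith)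
  have hp6 : (ε' * T) ^ (1 - (k : ℝ)) ≤ ε' ^ (1 - (k : ℝ)) * T ^ (-(2 * θ + 3)) := by
    rw [Real.mul_rpow hε'0.le hT0.le]
    apply mul_le_mul_of_nonneg_left _ (Real.rpow_nonneg hε'0.le _)
    exact Real.rpow_le_rpow_of_exponent_le hT1 (by linarith)
  -- the three error terms are `≤ (constant)/T`
  have ht1 : Cw' * T ^ (-v) * Mb ≤ Cw' * C₁ * T⁻¹ := by
    calc Cw' * T ^ (-v) * Mb = Cw' * C₁ * (T ^ (-v) * (T ^ θ) ^ 2) := by rw [hMb]; ring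
      _ ≤ Cw' * C₁ * T⁻¹ := by
          apply mul_le_mul_of_nonneg_left _ (by positivity)
          rw [hp1]; exact hp2
  have hlogT : Real.log T ≤ T := (Real.log_le_sub_one_of_pos hT0).trans (by linarith)
  have hLb : 2 * ((1 + η + θ) * Real.log T / (2 * π) + 1 / π) + 2 * D2 ≤ T * cst := by
    have h1 : (1 + η + θ) * Real.log T / (2 * π) ≤ (3 + θ) * T / (2 * π) := by
      apply div_le_div_of_nonneg_right _ (by positivity)
      have hlog0 : 0 ≤ Real.log T := Real.log_nonneg hT1
      calc (1 + η + θ) * Real.log T ≤ (3 + θ) * Real.log T := by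
            apply mul_le_mul_of_nonneg_right _ hlog0; linarith
        _ ≤ (3 + θ) * T := by apply mul_le_mul_of_nonneg_left hlogT; linarith
    have h2 : 2 / π ≤ T * (2 / π) := le_mul_of_one_le_left (by positivity) hT1
    have h3 : 2 * D2 ≤ T * (2 * D2) := le_mul_of_one_le_left (by positivity) hT1
    have h4 : 2 * ((3 + θ) * T / (2 * π)) = T * ((3 + θ) / π) := by field_simp
    calc 2 * ((1 + η + θ) * Real.log T / (2 * π) + 1 / π) + 2 * D2
        = 2 * ((1 + η + θ) * Real.log T / (2 * π)) + 2 / π + 2 * D2 := by ring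
      _ ≤ 2 * ((3 + θ) * T / (2 * π)) + T * (2 / π) + T * (2 * D2) := by gcongr
      _ = T * cst := by rw [h4, hcst]; ring
  have ht3 : Cw' * T ^ (-v) * Mb * (2 * ((1 + η + θ) * Real.log T / (2 * π) + 1 / π) + 2 * D2) ≤
      Cw' * C₁ * cst * T⁻¹ := by
    have hnn : 0 ≤ 2 * ((1 + η + θ) * Real.log T / (2 * π) + 1 / π) + 2 * D2 := by
      have : 0 ≤ Real.log T := Real.log_nonneg hT1
      positivity
    calc Cw' * T ^ (-v) * Mb * (2 * ((1 + η + θ) * Real.log T / (2 * π) + 1 / π) + 2 * D2)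
        = Cw' * C₁ * (T ^ (-v) * (T ^ θ) ^ 2) *
            (2 * ((1 + η + θ) * Real.log T / (2 * π) + 1 / π) + 2 * D2) := by rw [hMb]; ring
      _ ≤ Cw' * C₁ * T ^ (-3 : ℝ) * (T * cst) := by
          rw [hp1]
          exact mul_le_mul_of_nonneg_left hLb (by positivity)
      _ = Cw' * C₁ * cst * (T ^ (-3 : ℝ) * T) := by ring
      _ ≤ Cw' * C₁ * cst * T⁻¹ := mul_le_mul_of_nonneg_left hp3 (by positivity)
  have ht2 : (1 + T ^ (1 + η) * Mb) * (2 * (Dk * (ε' * T) ^ (1 - (k : ℝ)) / ((k : ℝ) - 1))) ≤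
      2 * Dk * ε' ^ (1 - (k : ℝ)) * (1 + C₁) / ((k : ℝ) - 1) * T⁻¹ := by
    have hfac : 0 ≤ 1 + T ^ (1 + η) * Mb := by positivity
    calc (1 + T ^ (1 + η) * Mb) * (2 * (Dk * (ε' * T) ^ (1 - (k : ℝ)) / ((k : ℝ) - 1)))
        ≤ (1 + T ^ (1 + η) * Mb) *
            (2 * (Dk * (ε' ^ (1 - (k : ℝ)) * T ^ (-(2 * θ + 3))) / ((k : ℝ) - 1))) := by
          apply mul_le_mul_of_nonneg_left _ hfac
          apply mul_le_mul_of_nonneg_left _ zero_le_two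
          apply div_le_div_of_nonneg_right _ hk1.le
          exact mul_le_mul_of_nonneg_left hp6 hDk0
      _ = 2 * Dk * ε' ^ (1 - (k : ℝ)) / ((k : ℝ) - 1) *
            (T ^ (-(2 * θ + 3)) + C₁ * (T ^ (1 + η) * (T ^ θ) ^ 2 * T ^ (-(2 * θ + 3)))) := by
          rw [hMb]; field_simp
      _ ≤ 2 * Dk * ε' ^ (1 - (k : ℝ)) / ((k : ℝ) - 1) * (T⁻¹ + C₁ * T⁻¹) := by
          apply mul_le_mul_of_nonneg_left _ (div_nonneg (by positivity) hk1.le)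
          exact add_le_add hp4 (mul_le_mul_of_nonneg_left hp5 hC₁0)
      _ = 2 * Dk * ε' ^ (1 - (k : ℝ)) * (1 + C₁) / ((k : ℝ) - 1) * T⁻¹ := by
          field_simp
  have herr : Cw' * T ^ (-v) * Mb
      + (1 + T ^ (1 + η) * Mb) * (2 * (Dk * (ε' * T) ^ (1 - (k : ℝ)) / ((k : ℝ) - 1)))
      + Cw' * T ^ (-v) * Mb *
          (2 * ((1 + η + θ) * Real.log T / (2 * π) + 1 / π) + 2 * D2) ≤ ε / 4 := by
    have hsum : Cw' * C₁ * T⁻¹ + 2 * Dk * ε' ^ (1 - (k : ℝ)) * (1 + C₁) / ((k : ℝ) - 1) * T⁻¹ +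
        Cw' * C₁ * cst * T⁻¹ = Kc * T⁻¹ := by rw [hKc]; ring
    have hKT : Kc * T⁻¹ ≤ ε / 4 := by
      rw [← div_eq_mul_inv, div_le_iff₀ hT0]
      rw [div_le_iff₀ hε] at hTK
      linarith
    linarith
  exact propA_core hε hε1 hθ hA hη0 (le_of_eq hη) hε'0 hε'A hk2 hw01 hCw'0 hMb0 hTε hTπ
    hAFE' herr S hS hsep a haMb

end Literature.Barriers.RiemannHypothesis
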